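import Mathlib
import Literature.Combinatorics.Optimization.TracialDesigns
import Summits.PneNP.PneNP.Theorems.ChebyshevTracialDesignEdgeAdditiveRigidity
import Summits.PneNP.PneNP.Theorems.ChebyshevTracialDesignProfileInterpolation
import Summits.PneNP.PneNP.Theorems.ChebyshevTracialDesignLevelMarginals

/-!
# Cell pnp-psdrank, route `ChebyshevTracialDesign`: edge-additive pure states are slack multiples, and squared slack multiples
# have NONPOSITIVE value under every exact design of degree `≥ 2` (crux `TracialDecayExp20`, stmt-PneNP-19878; eng g12, MEMO-12 §3)

Consequences of the rigidity theorem `ChebyshevTracialDesignEdgeAdditiveRigidity.edgeSum_eq_mul_slack` in the route's vocabulary: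
* `inner_edgeAdditive_eq_mul_slack` — a pure state `⟨p_U, q_M⟩` whose matching-side vectors are EDGE-ADDITIVE, `q_M = Σ_{e ∈ M} β(e)`
  (any `β : edges → ℝ^r`, any cut vector `p_U`), orthogonal on the tight pairs of a cut `U` (`3 ≤ |U| ≤ n − 3`), equals `λ_U·(cc(U,M) − 1)`
  on every perfect matching: its square has the level profile `λ_U² (c − 1)²` of lit's slack factor [cite: Rothvoss2017, §2 (PDF pp. 5–6)];
* `design_sum_sqSlack` — the calibration `Σ_c w_c (c − 1)² = −1` of an exact extrapolation design of degree `≥ 2`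
  [cite: CoppersmithRivlin1992, Thm. (p. 970)];
* `design_value_sqSlack_multiple(_nonpos)` — for the multilevel weight `W = levelWeight n t C w` of such a design and ANY cut weights
  `λ_U`: `Σ_{U,M} W(U,M) λ_U² (cc(U,M) − 1)² = −(Σ_{|U|=t} λ_U²)/#{U : |U| = t} ≤ 0` (uniform marginals of the level classes,
  `ChebyshevTracialDesignLevelMarginals.sum_Qset_fst`).
So the edge-additive class — the degree-one-in-`M` kernels with arbitrary dependence on the cut, which contains lit's slack factor and
every 'per-edge feature vector' strategy — is immune for the crux in every dimension: no symmetry, spreadness or low degree on the cut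
side is needed. Stature: support/instrument. WHAT THIS IS NOT: nothing on general psd strategies, nothing on psd rank of `P_PM(K_n)`,
no P-vs-NP content.
-/

set_option linter.dupNamespace false -- `Summit.PneNP.PneNP.…`: summit = sub-problem (D-0017)

noncomputable section

namespace Summit.PneNP.PneNP.Theorems.ChebyshevTracialDesignEdgeAdditiveValue

open Finset Literature.Barriers.PneNP Literature.Combinatorics.SimpleGraph.CycleSpace Literature.Combinatorics.Optimization
open Summit.PneNP.PneNP.Theorems.ChebyshevTracialDesignEdgeAdditiveRigidity

variable {n : ℕ}

/-! ### §1 Edge-additive pure states: `⟨p_U, Σ_{e∈M} β_e⟩` tight ⇒ a multiple of the slack -/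

/-- **Edge-additive matching-side vectors are rigid.** If `q_M = Σ_{e ∈ M} β(e)` (any vectors `β(e) ∈ ℝ^r`) and a cut vector
`p ∈ ℝ^r` is orthogonal to `q_M` for every `M` tight for `U` (`3 ≤ |U| ≤ n − 3`, `n` even), then `⟨p, q_M⟩ = λ·(cc(U,M) − 1)` for all
perfect matchings `M`. [cite: Rothvoss2017, §2 (PDF pp. 5–6)] -/
theorem inner_edgeAdditive_eq_mul_slack (hn : Even n) (U : OddSet n) (h3 : 3 ≤ U.1.card) (h3' : U.1.card + 3 ≤ n)
    {r : ℕ} (p : Fin r → ℝ) (β : Sym2 (Fin n) → Fin r → ℝ)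
    (h : ∀ M : PMatch n, cc U M = 1 → ∑ k, p k * (∑ e ∈ M.1, β e k) = 0) :
    ∃ lam : ℝ, ∀ M : PMatch n, ∑ k, p k * (∑ e ∈ M.1, β e k) = lam * ((cc U M : ℝ) - 1) := by
  have hswap : ∀ M : PMatch n, ∑ k, p k * (∑ e ∈ M.1, β e k) = ∑ e ∈ M.1, ∑ k, p k * β e k := by
    intro M; simp_rw [mul_sum]; exact sum_comm
  obtain ⟨lam, hlam⟩ := edgeSum_eq_mul_slack hn U h3 h3' (fun e => ∑ k, p k * β e k)
    (fun M hM => by rw [← hswap]; exact h M hM)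
  exact ⟨lam, fun M => by rw [hswap]; exact hlam M⟩

/-! ### §2 The value of a squared slack multiple under an exact design of degree `≥ 2` is `≤ 0` -/

/-- The calibration `Σ_{c ∈ C} w_c (c − 1)² = −1` of an exact design of degree `≥ 2` (exactness on `p = (X − 1)²`). -/
theorem design_sum_sqSlack {t T D : ℕ} {B : ℝ} {C : Finset ℕ} {w : ℕ → ℝ} (hD : IsExactDesign n t T D B C w)
    (h2 : 2 ≤ D) : ∑ c ∈ C, w c * ((c : ℝ) - 1) ^ 2 = -1 := by
  have hp := hD.2.2.2.2.2.1 ((Polynomial.X - Polynomial.C 1) ^ 2) (by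
    calc ((Polynomial.X - Polynomial.C (1 : ℝ)) ^ 2).natDegree ≤ 2 * (Polynomial.X - Polynomial.C (1 : ℝ)).natDegree :=
          Polynomial.natDegree_pow_le
      _ ≤ 2 * 1 := by gcongr; exact (Polynomial.natDegree_X_sub_C_le (1:ℝ)).trans le_rfl
      _ ≤ D := by omega)
  simp only [Polynomial.eval_pow, Polynomial.eval_sub, Polynomial.eval_X, Polynomial.eval_C] at hp
  rw [hp]; norm_num

/-- **Squared slack multiples have nonpositive design value.** For an exact design of degree `D ≥ 2` on the `t`-cuts and any
cut weights `λ_U`: `Σ_{U,M} W(U,M) · λ_U² (cc(U,M) − 1)² = −(Σ_{|U|=t} λ_U²)/#{U : |U| = t} ≤ 0` — so (with §1 and the rigidity theorem) every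
edge-additive tight kernel, squared, is priced `≤ 0` by every such design, in every dimension.
[cite: Rothvoss2017, §2 (PDF p. 6, eq. (2))] [cite: CoppersmithRivlin1992, Thm. (p. 970)] -/
theorem design_value_sqSlack_multiple {t T D : ℕ} {B : ℝ} {C : Finset ℕ} {w : ℕ → ℝ} (hD : IsExactDesign n t T D B C w)
    (h2 : 2 ≤ D) (lam : OddSet n → ℝ) :
    ∑ U, ∑ M, levelWeight n t C w U M * (lam U ^ 2 * ((cc U M : ℝ) - 1) ^ 2) =
      -(∑ U ∈ univ.filter (fun U : OddSet n => U.1.card = t), lam U ^ 2) /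
        ((univ.filter (fun U : OddSet n => U.1.card = t)).card : ℝ) := by
  classical
  rw [ChebyshevTracialDesignProfileInterpolation.sum_levelWeight_mul]
  have hne := hD.2.2.2.1
  have hterm : ∀ c ∈ C, w c / ((Qset n t c).card : ℝ) * ∑ q ∈ Qset n t c, lam q.1 ^ 2 * ((cc q.1 q.2 : ℝ) - 1) ^ 2 =
      w c * ((c : ℝ) - 1) ^ 2 * ((∑ U ∈ univ.filter (fun U : OddSet n => U.1.card = t), lam U ^ 2) /
        ((univ.filter (fun U : OddSet n => U.1.card = t)).card : ℝ)) := by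
    intro c hc
    obtain ⟨q₀, hq₀⟩ := (hne c hc).2.2.2
    have hU₀ : q₀.1.1.card = t := (mem_Qset_iff.1 hq₀).1
    have hlev : ∑ q ∈ Qset n t c, lam q.1 ^ 2 * ((cc q.1 q.2 : ℝ) - 1) ^ 2 =
        ((c : ℝ) - 1) ^ 2 * ∑ q ∈ Qset n t c, lam q.1 ^ 2 := by
      rw [mul_sum]
      refine sum_congr rfl fun q hq => ?_
      rw [(mem_Qset_iff.1 hq).2]; ring
    have hRc0 : ((univ.filter fun M : PMatch n => cc q₀.1 M = c).card : ℝ) ≠ 0 := by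
      have hpos : (0 : ℝ) < ((Qset n t c).card : ℝ) := by exact_mod_cast card_pos.2 ⟨q₀, hq₀⟩
      rw [ChebyshevTracialDesignLevelMarginals.card_Qset_eq_rowCount_mul t c q₀.1 hU₀] at hpos
      intro h0; rw [h0, zero_mul] at hpos; exact lt_irrefl _ hpos
    have hNt0 : ((univ.filter (fun U : OddSet n => U.1.card = t)).card : ℝ) ≠ 0 := by
      have : q₀.1 ∈ univ.filter (fun U : OddSet n => U.1.card = t) := mem_filter.2 ⟨mem_univ _, hU₀⟩
      exact_mod_cast (card_pos.2 ⟨_, this⟩).ne'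
    rw [hlev, ChebyshevTracialDesignLevelMarginals.sum_Qset_fst t c (fun U => lam U ^ 2) q₀.1 hU₀,
      ChebyshevTracialDesignLevelMarginals.card_Qset_eq_rowCount_mul t c q₀.1 hU₀]
    field_simp
  rw [sum_congr rfl hterm, ← sum_mul, design_sum_sqSlack hD h2]
  ring

/-- … in particular the value is `≤ 0`. -/
theorem design_value_sqSlack_multiple_nonpos {t T D : ℕ} {B : ℝ} {C : Finset ℕ} {w : ℕ → ℝ}
    (hD : IsExactDesign n t T D B C w) (h2 : 2 ≤ D) (lam : OddSet n → ℝ) :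
    ∑ U, ∑ M, levelWeight n t C w U M * (lam U ^ 2 * ((cc U M : ℝ) - 1) ^ 2) ≤ 0 := by
  rw [design_value_sqSlack_multiple hD h2 lam]
  have h1 : 0 ≤ ∑ U ∈ univ.filter (fun U : OddSet n => U.1.card = t), lam U ^ 2 :=
    sum_nonneg fun U _ => sq_nonneg _
  have h2' : (0 : ℝ) ≤ ((univ.filter (fun U : OddSet n => U.1.card = t)).card : ℝ) := by positivity
  rw [neg_div]
  exact neg_nonpos.mpr (div_nonneg h1 h2')

end Summit.PneNP.PneNP.Theorems.ChebyshevTracialDesignEdgeAdditiveValue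

end
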